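import Mathlib.FieldTheory.IsAlgClosed.AlgebraicClosure
import Literature.AnabelianGeometry.AbsoluteAnabelian.FreeProfiniteCommutatorCusp
import Literature.AnabelianGeometry.AbsoluteAnabelian.FreeProSigmaNonVacuity
import Literature.AnabelianGeometry.AbsoluteAnabelian.AbsTopILem45iModelProofs
import Literature.AnabelianGeometry.AbsoluteAnabelian.AbsTopIII.CcnTransgressionFreeGeom
import Literature.AnabelianGeometry.AbsoluteAnabelian.AbsTopIII.CurveModelProp14iiReduction
import Literature.GroupTheory.ProfiniteSubquotients
import HarnessLib

/-!
# The once-punctured-torus model satisfies the WHOLE [AbsTopIII] Prop. 1.4 package non-degenerately (F-0339 · F-0340 · F-0341 · F-0338 · F-0365)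

Mochizuki, *Topics in Absolute Anabelian Geometry III*, §1, Prop. 1.4 (i)/(ii), manuscript p. 31 (lit key
`paper:url-5493eb38cbb7`).  Companion of `CurveModelOncePuncturedTorus.lean` (abc-iut-f-076: the model over
`k = ℚ̄` with `Π_{U_x} = F̂₂ = ⟨a, b⟩^`, one cusp `I_x = ⟨[a, b]⟩⁻`, `Π_X = F̂₂/⟨⟨[a, b]⟩⟩⁻`, `res =` the quotient
map is a genuine cyclotome presentation at which F-0338/F-0365 hold).  The `CurveModel`-relative named facts
of Prop. 1.4 — `Prop_1_4_i` (F-0339: cuspidal inertia groups are free procyclic), `Prop_1_4_i'` (F-0340: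
`Π_U ↠ Π_{U'}` surjective with bijective Galois part and kernel the closed normal closure of the inertia
groups of some cusps), `Prop_1_4_ii` (F-0341: `1 → I_x → Δ^{c-cn}_{U_x} → Δ_X → 1` exact),
`Prop_1_4_ii_transgression` (F-0338), `Prop_1_4_ii_sync` (F-0365) — have REFUTED universal closures and were
jointly MODEL-witnessed so far only at DEGENERATE data (abc-iut-f-056's `CurveModel.exists_facts_nonVacuous`:
`Δ = 1`, no cusps; abc-iut-L4-t1's toy `G_k × Ẑ ↠ G_k`: `Δ_X = 1`).  This proof-only file (no definitions)
records that ALL FIVE hold SIMULTANEOUSLY at the once-punctured-torus model, which has an honest cusp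
(`I_x ≅ Ẑ`), `Δ_{U_x} = F̂₂` and `Δ_X ≅ Ẑ² ≠ 1`:

* `CurveModel.exists_oncePuncturedTorus_prop_1_4` — `∃ M Ux X h x, M.IsCyclotomePresentation h x ∧
  (M.ext X).geom ≠ ⊥ ∧ M.Prop_1_4_i ∧ M.Prop_1_4_i' ∧ M.Prop_1_4_ii ∧ M.Prop_1_4_ii_transgression ∧
  M.Prop_1_4_ii_sync` (the construction of the companion file is repeated inside the proof — proof-only
  style admits no shared definition; `Prop_1_4_i'` with `S = {x}`: `Ker(F̂₂ ↠ F̂₂/⟨⟨[a,b]⟩⟩⁻) = ⟨⟨I_x⟩⟩⁻`;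
  `Prop_1_4_ii` by abc-iut's reduction `prop_1_4_ii_iff_inf_eq_bot` to `⟨[a,b]⟩⁻ ∩ [⟨⟨[a,b]⟩⟩⁻, F̂₂]⁻ = 1`,
  `IsFreeProOn.topologicalClosure_zpowers_commutator_inf_eq_bot`).

HONEST LABEL: a group-theoretic model (profinite completions of topological `π₁`'s over an algebraically
closed base, `Π = Δ`), not the étale `π₁` of a scheme; a witness is consistency evidence (the five rows are
jointly satisfiable at non-degenerate data), not an endorsement.  Nothing here bears on [IUTchIII] Cor. 3.12;
typed ≠ proved.
-/

noncomputable section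

open CategoryTheory Topology

namespace Literature.AnabelianGeometry.AbsoluteAnabelian.AbsTopIII

open Literature.IUT.HodgeTheaters (profiniteCompletion toCompletion)

/-- Over an algebraically closed field the absolute Galois group is trivial. [folklore] -/
private theorem subsingleton_absoluteGaloisGroup (k : Type) [Field k] [IsAlgClosed k] :
    Subsingleton (Field.absoluteGaloisGroup k) := by
  refine ⟨fun σ τ => AlgEquiv.ext fun x => ?_⟩
  obtain ⟨a, rfl⟩ :=
    (IsAlgClosed.algebraMap_bijective_of_isIntegral (k := k) (K := AlgebraicClosure k)).2 x
  rw [AlgEquiv.commutes, AlgEquiv.commutes]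

/-- For an extension whose Galois group is trivial, `Δ = Π`. [folklore] -/
private theorem geom_eq_top_of_subsingleton (E : FundamentalExtension.{0}) [Subsingleton E.gal] :
    E.geom = ⊤ := by
  rw [eq_top_iff]
  intro x _
  rw [FundamentalExtension.mem_geom]
  exact Subsingleton.elim _ _

/-- **All of [AbsTopIII] Prop. 1.4, relative to a model, holds at the once-punctured torus**: there is a
model `M : CurveModel` (`k = ℚ̄`, `Π_{U_x} = F̂₂`, one cusp `x` with `I_x = ⟨[a,b]⟩⁻ ≅ Ẑ`,
`Π_X = F̂₂/⟨⟨[a,b]⟩⟩⁻ ≠ 1`, `res` the quotient map) with a cyclotome presentation `(U_x ⊆ X, x)` at which the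
five named facts `Prop_1_4_i` (F-0339), `Prop_1_4_i'` (F-0340), `Prop_1_4_ii` (F-0341),
`Prop_1_4_ii_transgression` (F-0338) and `Prop_1_4_ii_sync` (F-0365) hold simultaneously and non-degenerately.
[cite: MochizukiAbsTopIII2015, Prop 1.4 p.31] -/
theorem CurveModel.exists_oncePuncturedTorus_prop_1_4 :
    ∃ (M : CurveModel.{0}) (Ux X : M.Curve) (h : M.IsCofiniteOpen Ux X) (x : (M.cusps Ux).Cusp),
      M.IsCyclotomePresentation h x ∧ (M.ext X).geom ≠ ⊥ ∧ M.Prop_1_4_i ∧ M.Prop_1_4_i' ∧ M.Prop_1_4_ii ∧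
        M.Prop_1_4_ii_transgression ∧ M.Prop_1_4_ii_sync := by
  classical
  -- the base field `ℚ̄` and its trivial Galois group
  haveI : Subsingleton (Field.absoluteGaloisGroup (AlgebraicClosure ℚ)) :=
    subsingleton_absoluteGaloisGroup _
  -- `F̂₂`, free profinite on the two letters
  let P : ProfiniteGrp.{0} := profiniteCompletion (FreeGroup (Fin 2))
  let gens : Fin 2 → P := fun i => toCompletion (FreeGroup (Fin 2)) (FreeGroup.of i)
  have hP : IsFreeProOn P {p : ℕ | p.Prime} gens := isFreeProOn_profiniteCompletion_freeGroup 2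
  have hS : ∀ p : ℕ, p.Prime → p ∈ {p : ℕ | p.Prime} := fun p hp => hp
  have h01 : (0 : Fin 2) ≠ 1 := by decide
  -- the cusp: `c = [a, b]`, `I = ⟨c⟩⁻`, `N = ⟨⟨I⟩⟩⁻`
  let c : P := gens 0 * gens 1 * (gens 0)⁻¹ * (gens 1)⁻¹
  let I : Subgroup P := (Subgroup.zpowers c).topologicalClosure
  let N : Subgroup P := (Subgroup.normalClosure (I : Set P)).topologicalClosure
  have hIc : IsClosed (I : Set P) := Subgroup.isClosed_topologicalClosure _
  have hNc : IsClosed (N : Set P) := Subgroup.isClosed_topologicalClosure _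
  haveI hNn : N.Normal := Subgroup.is_normal_topologicalClosure _
  have hIfree : FundamentalExtension.IsFreeProcyclic I :=
    hP.isFreeProcyclic_topologicalClosure_zpowers_commutator hS h01
  have hIle : I ≤ (⁅(⊤ : Subgroup P), (⊤ : Subgroup P)⁆).topologicalClosure :=
    topologicalClosure_zpowers_commutator_le _ _
  have hIN : I ⊓ (⁅N, (⊤ : Subgroup P)⁆).topologicalClosure = ⊥ :=
    hP.topologicalClosure_zpowers_commutator_inf_eq_bot hS h01
  -- the quotient `F̂₂ / N` as a profinite group
  haveI : TotallyDisconnectedSpace (P ⧸ N) :=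
    Literature.GroupTheory.ProfiniteSubquotients.totallyDisconnectedSpace_quotient N hNc
  let Q : ProfiniteGrp.{0} := ProfiniteGrp.of (P ⧸ N)
  -- the two extensions (`G = G_{ℚ̄} = 1`, augmentation trivial) and the quotient morphism
  let G : ProfiniteGrp.{0} := absoluteGaloisGrp (AlgebraicClosure ℚ)
  let E₁ : FundamentalExtension.{0} :=
    { arith := P, gal := G, aug := 1, aug_surjective := fun g => ⟨1, Subsingleton.elim _ _⟩ }
  let E₀ : FundamentalExtension.{0} :=
    { arith := Q, gal := G, aug := 1, aug_surjective := fun g => ⟨1, Subsingleton.elim _ _⟩ }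
  let π : P →ₜ* (P ⧸ N) :=
    { QuotientGroup.mk' N with continuous_toFun := QuotientGroup.continuous_mk }
  let q : E₁ ⟶ E₀ := ⟨π, ContinuousMonoidHom.id _, fun _ => Subsingleton.elim _ _⟩
  have hE₁ : E₁.geom = ⊤ := geom_eq_top_of_subsingleton E₁
  have hE₀ : E₀.geom = ⊤ := geom_eq_top_of_subsingleton E₀
  -- cusps: one cusp of `U_x` with `D = I`; none on `X`
  let C₁ : E₁.CuspidalData :=
    { Cusp := PUnit
      Dcusp := fun _ => I
      Icusp := fun _ => I ⊓ E₁.geom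
      Icusp_eq := fun _ => rfl
      isClosed_Dcusp := fun _ => hIc
      eq_of_conj := fun x y _ _ => Subsingleton.elim x y }
  let C₀ : E₀.CuspidalData :=
    { Cusp := PEmpty
      Dcusp := fun x => x.elim
      Icusp := fun x => x.elim
      Icusp_eq := fun x => x.elim
      isClosed_Dcusp := fun x => x.elim
      eq_of_conj := fun x => x.elim }
  have hC₁ : ∀ x, C₁.Icusp x = I := fun x => by
    change I ⊓ E₁.geom = I
    rw [hE₁, inf_top_eq]
  -- the model: `Curve = {X, U_x}` (`false ↦ X`, `true ↦ U_x`)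
  let M : CurveModel.{0} :=
    { Curve := ULift.{1} Bool
      base := fun _ => AlgebraicClosure ℚ
      ext := fun U => cond U.down E₁ E₀
      galIso := fun U => by
        rcases U with ⟨_ | _⟩ <;> exact Iso.refl _
      cusps := fun U => by
        rcases U with ⟨_ | _⟩
        exacts [C₀, C₁]
      IsProper := fun U => U = ⟨false⟩
      IsScheme := fun _ => True
      genus := fun _ => 1
      FunctionField := fun _ => AlgebraicClosure ℚ
      Point := fun _ => PEmpty
      decomp := fun _ x => x.elim
      IsNFCurve := fun _ => True
      IsNFPoint := fun _ x => x.elim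
      IsNFRational := fun _ _ => True
      IsNFConstant := fun _ _ => True
      NFFunctionField := fun _ => AlgebraicClosure ℚ
      IsStrictlyBelyiType := fun _ => False
      IsCofiniteOpen := fun U U' => U = ⟨true⟩ ∧ U' = ⟨false⟩
      res := fun {U U'} h => by
        obtain ⟨rfl, rfl⟩ := h
        exact q }
  -- the presentation `(U_x ⊆ X, x)`
  have hpres : M.IsCyclotomePresentation (Ux := ⟨true⟩) (X := ⟨false⟩) ⟨rfl, rfl⟩ PUnit.unit := by
    have hrat : C₁.IsRational PUnit.unit := fun g _ => ⟨1, I.one_mem, Subsingleton.elim _ _⟩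
    have hker : cuspidalKernel q = (Subgroup.normalClosure (C₁.Icusp PUnit.unit : Set P)).topologicalClosure := by
      rw [hC₁]
      change q.arith.toMonoidHom.ker ⊓ E₁.geom = N
      rw [hE₁, inf_top_eq]
      exact QuotientGroup.ker_mk' N
    refine
      { isScheme := ⟨trivial, trivial⟩
        isProper := rfl
        isRational := hrat
        isFreeProcyclic := by
          change FundamentalExtension.IsFreeProcyclic (C₁.Icusp PUnit.unit)
          rw [hC₁]
          exact hIfree
        kernel_eq := hker
        isCuspidallyCentral := ?_ }
    change IsCuspidallyCentralExtension q (C₁.Icusp PUnit.unit)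
    rw [isCuspidallyCentralExtension_iff_inf_eq_bot q C₁ PUnit.unit hrat hker]
    unfold cuspidallyCentralModulus
    rw [hker, hC₁, hE₁]
    exact hIN
  -- every cyclotome presentation of `M` is this one, up to the cusp index: the structural inputs
  have hq : ∀ (Ux X : M.Curve) (h : M.IsCofiniteOpen Ux X) (x : (M.cusps Ux).Cusp),
      M.IsCyclotomePresentation h x →
        Set.SurjOn (M.res h).arith (M.ext Ux).geom (M.ext X).geom := by
    intro Ux X h x _
    obtain ⟨rfl, rfl⟩ := h
    change Set.SurjOn π E₁.geom E₀.geom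
    rw [hE₁, hE₀]
    rintro y -
    obtain ⟨g, rfl⟩ := QuotientGroup.mk_surjective y
    exact ⟨g, Subgroup.mem_top g, rfl⟩
  have hI : ∀ (Ux X : M.Curve) (h : M.IsCofiniteOpen Ux X) (x : (M.cusps Ux).Cusp),
      M.IsCyclotomePresentation h x →
        (M.cusps Ux).Icusp x ≤ (⁅(M.ext Ux).geom, (M.ext Ux).geom⁆).topologicalClosure := by
    intro Ux X h x _
    obtain ⟨rfl, rfl⟩ := h
    change C₁.Icusp x ≤ (⁅E₁.geom, E₁.geom⁆).topologicalClosure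
    rw [hC₁, hE₁]
    exact hIle
  have hfree : ∀ (Ux X : M.Curve) (h : M.IsCofiniteOpen Ux X) (x : (M.cusps Ux).Cusp),
      M.IsCyclotomePresentation h x → IsFreePro (M.ext Ux).geom {p : ℕ | p.Prime} := by
    intro Ux X h x _
    obtain ⟨rfl, rfl⟩ := h
    change IsFreePro E₁.geom {p : ℕ | p.Prime}
    rw [hE₁]
    let e : P ≃ₜ* (⊤ : Subgroup P) :=
      { Subgroup.topEquiv.symm with
        continuous_toFun := Continuous.subtype_mk continuous_id _
        continuous_invFun := continuous_subtype_val }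
    exact ⟨2, _, hP.of_continuousMulEquiv e⟩
  -- F-0339: every cuspidal inertia group is free procyclic (the one cusp of `U_x`; `X` has none)
  have h14i : M.Prop_1_4_i := by
    rintro ⟨_ | _⟩ _ x
    · exact x.elim
    · change FundamentalExtension.IsFreeProcyclic (C₁.Icusp x)
      rw [hC₁]
      exact hIfree
  -- F-0340: `res` is surjective with bijective Galois part and kernel `⟨⟨I_x⟩⟩⁻`
  have h14i' : M.Prop_1_4_i' := by
    intro U U' h _ _
    obtain ⟨rfl, rfl⟩ := h
    change Function.Surjective π ∧ Function.Bijective (ContinuousMonoidHom.id G) ∧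
      ∃ S : Set C₁.Cusp, π.toMonoidHom.ker =
        (Subgroup.normalClosure (⋃ c ∈ S, (C₁.Icusp c : Set P))).topologicalClosure
    refine ⟨QuotientGroup.mk'_surjective N, Function.bijective_id, Set.univ, ?_⟩
    have hU : (⋃ c ∈ (Set.univ : Set C₁.Cusp), (C₁.Icusp c : Set P)) = (I : Set P) := by
      ext g
      simp only [Set.mem_iUnion, Set.mem_univ, hC₁, SetLike.mem_coe, exists_const]
    rw [hU]
    exact QuotientGroup.ker_mk' N
  -- F-0341: exactness of `1 → I_x → Δ^{c-cn}_{U_x} → Δ_X → 1`, via the reduction to the injectivity clause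
  have h14ii : M.Prop_1_4_ii := by
    rw [CurveModel.prop_1_4_ii_iff_inf_eq_bot]
    intro Ux X h _ _ _ x hx hker
    obtain ⟨rfl, rfl⟩ := h
    change C₁.Icusp x ⊓ cuspidallyCentralModulus q = ⊥
    change cuspidalKernel q = (Subgroup.normalClosure (C₁.Icusp x : Set P)).topologicalClosure at hker
    unfold cuspidallyCentralModulus
    rw [hker, hC₁, hE₁]
    exact hIN
  refine ⟨M, ⟨true⟩, ⟨false⟩, ⟨rfl, rfl⟩, PUnit.unit, hpres, ?_, h14i, h14i', h14ii,
    M.prop_1_4_ii_transgression_of_isFreePro hS hq hI hfree,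
    M.prop_1_4_ii_sync_of_isFreePro hS hq hI hfree⟩
  -- `Δ_X = F̂₂ / N ≠ 1`: the class of `a` is nontrivial, as `a ∉ N ≤ [P, P]⁻` — via the continuous
  -- character `F̂₂ → ℤ/2` killing `b` (it kills every commutator, hence `N`, but not `a`)
  change E₀.geom ≠ ⊥
  rw [hE₀]
  intro htop
  have ha : (QuotientGroup.mk (gens 0) : P ⧸ N) = 1 := by
    have := (Subgroup.eq_bot_iff_forall _).mp htop (QuotientGroup.mk (gens 0)) (Subgroup.mem_top _)
    exact this
  rw [QuotientGroup.eq_one_iff] at ha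
  -- a continuous character to `ℤ/2` with `a ↦ 1`, `b ↦ 0`
  letI : TopologicalSpace (Multiplicative (ZMod 2)) := ⊥
  haveI : DiscreteTopology (Multiplicative (ZMod 2)) := ⟨rfl⟩
  obtain ⟨χ, hχc, hχa, hχb⟩ := hP.exists_continuous_hom_pair hS h01 (Multiplicative (ZMod 2))
    (Multiplicative.ofAdd 1) 1
  have hχI : I.map χ = ⊥ := by
    rw [eq_bot_iff]
    have h1 : I ≤ χ.ker.topologicalClosure := by
      refine Subgroup.topologicalClosure_mono ?_
      rw [Subgroup.zpowers_le, MonoidHom.mem_ker]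
      simp only [c, map_mul, map_inv, hχa, hχb, mul_one, inv_one, mul_inv_cancel]
    have hcl : IsClosed (χ.ker : Set P) := by
      rw [MonoidHom.coe_ker]
      exact (isClosed_discrete _).preimage hχc
    have h2 : χ.ker.topologicalClosure = χ.ker :=
      le_antisymm (Subgroup.topologicalClosure_minimal _ le_rfl hcl) (Subgroup.le_topologicalClosure _)
    rw [h2] at h1
    rintro _ ⟨g, hg, rfl⟩
    exact h1 hg
  have hχN : N ≤ χ.ker := by
    have hcl : IsClosed (χ.ker : Set P) := by
      rw [MonoidHom.coe_ker]
      exact (isClosed_discrete _).preimage hχc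
    refine Subgroup.topologicalClosure_minimal _ ?_ hcl
    refine Subgroup.normalClosure_le_normal ?_
    intro g hg
    rw [SetLike.mem_coe, MonoidHom.mem_ker, ← Subgroup.mem_bot, ← hχI]
    exact Subgroup.mem_map_of_mem χ hg
  have := hχN ha
  rw [MonoidHom.mem_ker, hχa] at this
  exact absurd this (by decide)

end Literature.AnabelianGeometry.AbsoluteAnabelian.AbsTopIII
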